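import Mathlib
import Literature.Analysis.Complex.DiscSubMeanValue
import HarnessLib

/-!
# Isolated singularities with a weighted area-`L¹` bound are poles of controlled order
# (crux `BoundaryClosureR`, stmt-CriticalPhenomena-14004, line `polygon-parity-squeeze`,
# registered sub-goal `pole_order_of_weightedL1`)

A pure one-variable analysis lemma used in the corner step of `stub_polygonIdentification`
(mechanism (A) of the line): if `H` is holomorphic on the punctured disc `B(c, r) ∖ {c}` and
`w ↦ ‖w - c‖ ^ γ ‖H w‖` is area-integrable there (`0 ≤ γ`), then for every natural `n > γ + 1`
the function `(z - c) ^ n H(z)` extends holomorphically across `c`; i.e. `H` has at worst a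
pole of order `≤ n` at `c`.

Proof (folklore).  Put `f(w) = (w - c) ^ n H(w)` and, for `z ≠ c` close to `c`, `s = ‖z - c‖ / 2`.
The disc `B(z, s)` lies in the punctured disc and on it `‖w - c‖ ≤ 3s`.  The area sub-mean-value
inequality `π s² ‖f z‖ ≤ ∫_{B(z,s)} ‖f‖` (mean value property on circles integrated in polar
coordinates, `Analysis.pi_mul_sq_mul_enorm_le_lintegral_ball`) and
`‖f w‖ = ‖w - c‖ ^ (n - γ) · ‖w - c‖ ^ γ ‖H w‖ ≤ (3s) ^ (n - γ) ‖w - c‖ ^ γ ‖H w‖` give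
`π s² ‖f z‖ ≤ (3s) ^ (n - γ) I` with `I` the weighted integral, whence
`‖z - c‖ ‖f z‖ ≤ C s ^ (n - γ - 1) → 0`: `f = o((z - c)⁻¹)` at `c`, and Riemann's removable
singularity theorem (`Complex.differentiableOn_update_limUnder_of_isLittleO`) applies.

Only Mathlib and the tree's polar-coordinate helpers (`Literature.Analysis.Complex.LengthArea`,
`Literature.Analysis.Complex.DiscSubMeanValue`) are used.
-/

noncomputable section

open Set Filter Metric MeasureTheory
open scoped Topology ENNReal NNReal Real

namespace Summit.CriticalPhenomena.SAWScalingLimit.Theorems.PolygonParitySqueeze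

namespace Analysis

/-- **Sub-mean-value inequality on circles, `L¹` form.**  For `g` holomorphic on `B(z, r)` and
`0 < ρ < r`: `2π ‖g z‖ ≤ ∫_{-π}^{π} ‖g(z + ρ e^{iθ})‖ dθ` (mean value property
`g z = ⨍ g(z + ρ e^{iθ}) dθ` and the triangle inequality), in `ℝ≥0∞`. [folklore] -/
theorem two_pi_mul_enorm_le_lintegral_circle {g : ℂ → ℂ} {z : ℂ} {r ρ : ℝ}
    (hg : DifferentiableOn ℂ g (ball z r)) (hρ : 0 < ρ) (hρr : ρ < r) :
    ENNReal.ofReal (2 * π) * ‖g z‖ₑ ≤ ∫⁻ θ in Ioo (-π) π, ‖g (circleMap z ρ θ)‖ₑ := by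
  -- adapted from `Literature.Analysis.Complex.two_pi_mul_enorm_sq_le_lintegral_circle`
  have hdc : DiffContOnCl ℂ g (ball z |ρ|) := by
    refine DifferentiableOn.diffContOnCl (hg.mono ?_)
    rw [abs_of_pos hρ, closure_ball z hρ.ne']
    exact closedBall_subset_ball hρr
  have hmv : Real.circleAverage g z ρ = g z := hdc.circleAverage
  rw [Real.circleAverage_eq_integral_add (-π),
    intervalIntegral.integral_comp_add_right (fun θ ↦ g (circleMap z ρ θ)), zero_add,
    show 2 * π + -π = π by ring] at hmv
  have hπ : -π ≤ π := by linarith [Real.pi_pos]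
  rw [← hmv, enorm_smul, intervalIntegral.integral_of_le hπ, ← mul_assoc]
  have hc : ENNReal.ofReal (2 * π) * ‖(2 * π)⁻¹‖ₑ = 1 := by
    rw [Real.enorm_eq_ofReal (by positivity), ← ENNReal.ofReal_mul (by positivity),
      mul_inv_cancel₀ (by positivity), ENNReal.ofReal_one]
  rw [hc, one_mul, restrict_Ioo_eq_restrict_Ioc]
  exact enorm_integral_le_lintegral_enorm _

/-- **Sub-mean-value inequality on discs, `L¹` form.**  For a measurable `g : ℂ → ℂ`
holomorphic on the disc `B(z, r)`, `r > 0`: `π r² ‖g z‖ ≤ ∫∫_{B(z,r)} ‖g‖` (the circle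
estimate multiplied by `ρ` and integrated over `0 < ρ < r`, i.e. polar coordinates about `z`),
in `ℝ≥0∞`. [folklore] -/
theorem pi_mul_sq_mul_enorm_le_lintegral_ball {g : ℂ → ℂ} {z : ℂ} {r : ℝ} (hr : 0 < r)
    (hg : DifferentiableOn ℂ g (ball z r)) (hgm : Measurable g) :
    ENNReal.ofReal (π * r ^ 2) * ‖g z‖ₑ ≤ ∫⁻ w in ball z r, ‖g w‖ₑ := by
  -- adapted from `Literature.Analysis.Complex.pi_mul_sq_mul_enorm_sq_le_lintegral_ball`
  set G : ℂ → ℝ≥0∞ := fun w ↦ ‖g w‖ₑ with hG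
  have hGm : Measurable G := hgm.enorm
  have hIm : Measurable ((ball z r).indicator G) := hGm.indicator measurableSet_ball
  -- polar coordinates about `z`
  have hpolar : ∫⁻ w in ball z r, G w = ∫⁻ ρ in Ioi (0 : ℝ), ∫⁻ θ in Ioo (-π) π,
      ENNReal.ofReal ρ * (ball z r).indicator G (circleMap z ρ θ) := by
    rw [← lintegral_indicator measurableSet_ball,
      ← lintegral_add_left_eq_self ((ball z r).indicator G) z,
      ← Complex.lintegral_comp_polarCoord_symm]
    simp only [Literature.Analysis.Complex.LengthArea.polarCoord_symm_eq, smul_eq_mul]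
    rw [Literature.Analysis.Complex.LengthArea.lintegral_polarCoord_target_eq]
    · rfl
    · exact measurable_fst.ennreal_ofReal.mul (hIm.comp (by fun_prop))
  rw [hpolar]
  have hc : ENNReal.ofReal (2 * π) * ‖g z‖ₑ ≠ ∞ :=
    ENNReal.mul_ne_top ENNReal.ofReal_ne_top enorm_ne_top
  calc ENNReal.ofReal (π * r ^ 2) * ‖g z‖ₑ
      = ∫⁻ ρ in Ioo (0 : ℝ) r, ENNReal.ofReal ρ * (ENNReal.ofReal (2 * π) * ‖g z‖ₑ) := by
        rw [lintegral_mul_const' _ _ hc,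
          Literature.Analysis.Complex.lintegral_Ioo_ofReal_self hr.le, ← mul_assoc,
          ← ENNReal.ofReal_mul (by positivity)]
        congr 2
        ring
    _ ≤ ∫⁻ ρ in Ioo (0 : ℝ) r, ENNReal.ofReal ρ * ∫⁻ θ in Ioo (-π) π, G (circleMap z ρ θ) := by
        refine setLIntegral_mono' measurableSet_Ioo fun ρ hρ ↦ ?_
        gcongr
        exact two_pi_mul_enorm_le_lintegral_circle hg hρ.1 hρ.2
    _ = ∫⁻ ρ in Ioo (0 : ℝ) r, ∫⁻ θ in Ioo (-π) π,
          ENNReal.ofReal ρ * (ball z r).indicator G (circleMap z ρ θ) := by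
        refine setLIntegral_congr_fun measurableSet_Ioo fun ρ hρ ↦ ?_
        rw [← lintegral_const_mul' _ _ ENNReal.ofReal_ne_top]
        refine lintegral_congr fun θ ↦ ?_
        rw [indicator_of_mem]
        rw [mem_ball, mem_sphere.1 (circleMap_mem_sphere z hρ.1.le θ)]
        exact hρ.2
    _ ≤ ∫⁻ ρ in Ioi (0 : ℝ), ∫⁻ θ in Ioo (-π) π,
          ENNReal.ofReal ρ * (ball z r).indicator G (circleMap z ρ θ) :=
        lintegral_mono_set Ioo_subset_Ioi_self

/-- **The key estimate.**  Let `H` be measurable and holomorphic on `B(c, r) ∖ {c}`, `γ ≤ n`,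
`z ≠ c` with `‖z - c‖ < 2r/3`, and `s = ‖z - c‖ / 2`.  Then `B(z, s) ⊆ B(c, r) ∖ {c}`, on it
`‖w - c‖ ≤ 3s`, so `‖(w - c) ^ n H(w)‖ ≤ (3s) ^ (n - γ) ‖w - c‖ ^ γ ‖H w‖`, and the area
sub-mean-value inequality gives
`π s² ‖(z - c) ^ n H(z)‖ ≤ (3s) ^ (n - γ) ∫_{B(c,r) ∖ {c}} ‖w - c‖ ^ γ ‖H w‖`. [folklore] -/
theorem pi_mul_sq_mul_enorm_pow_mul_le {H : ℂ → ℂ} {c : ℂ} {r γ : ℝ} {n : ℕ} (hγn : γ ≤ n)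
    (hHm : Measurable H) (hH : DifferentiableOn ℂ H (ball c r \ {c})) {z : ℂ} (hzc : z ≠ c)
    (hz : ‖z - c‖ < 2 * r / 3) :
    ENNReal.ofReal (π * (‖z - c‖ / 2) ^ 2) * ‖(z - c) ^ n * H z‖ₑ ≤
      ENNReal.ofReal ((3 * (‖z - c‖ / 2)) ^ ((n : ℝ) - γ)) *
        ∫⁻ w in ball c r \ {c}, ‖(‖w - c‖ ^ γ * ‖H w‖)‖ₑ := by
  set s : ℝ := ‖z - c‖ / 2 with hs
  have hzc' : 0 < ‖z - c‖ := norm_pos_iff.2 (sub_ne_zero.2 hzc)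
  have hs0 : 0 < s := by positivity
  have h2s : ‖z - c‖ = 2 * s := by rw [hs]; ring
  -- the disc `ball z s` lies in the punctured disc, at distance `< 3s` from `c`
  have hwc : ∀ w ∈ ball z s, w ≠ c ∧ ‖w - c‖ < 3 * s := by
    intro w hw
    rw [mem_ball, dist_eq_norm] at hw
    refine ⟨?_, ?_⟩
    · rintro rfl
      rw [norm_sub_rev, h2s] at hw
      linarith
    · calc ‖w - c‖ = ‖(w - z) + (z - c)‖ := by rw [sub_add_sub_cancel]
        _ ≤ ‖w - z‖ + ‖z - c‖ := norm_add_le _ _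
        _ < s + 2 * s := by linarith
        _ = 3 * s := by ring
  have hsub : ball z s ⊆ ball c r \ {c} := by
    intro w hw
    obtain ⟨hwc', hw3⟩ := hwc w hw
    refine ⟨?_, hwc'⟩
    rw [mem_ball, dist_eq_norm]
    have h3 : 3 * s < r := by rw [hs]; linarith
    linarith
  have hfd : DifferentiableOn ℂ (fun w => (w - c) ^ n * H w) (ball z s) :=
    DifferentiableOn.mono
      (fun w hw => ((differentiableWithinAt_id.sub_const c).pow n).mul (hH w hw)) hsub
  have hfm : Measurable fun w => (w - c) ^ n * H w :=
    ((measurable_id.sub_const c).pow_const n).mul hHm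
  have h1 := pi_mul_sq_mul_enorm_le_lintegral_ball hs0 hfd hfm
  -- pointwise weight comparison on the disc
  have hpt : ∀ w ∈ ball z s, (‖(w - c) ^ n * H w‖ₑ : ℝ≥0∞) ≤
      ENNReal.ofReal ((3 * s) ^ ((n : ℝ) - γ)) * ‖(‖w - c‖ ^ γ * ‖H w‖)‖ₑ := by
    intro w hw
    obtain ⟨hwc', hw3⟩ := hwc w hw
    have hwpos : 0 < ‖w - c‖ := norm_pos_iff.2 (sub_ne_zero.2 hwc')
    have hsplit : ‖w - c‖ ^ n = ‖w - c‖ ^ ((n : ℝ) - γ) * ‖w - c‖ ^ γ := by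
      rw [← Real.rpow_add hwpos, sub_add_cancel, Real.rpow_natCast]
    have hle : ‖w - c‖ ^ ((n : ℝ) - γ) ≤ (3 * s) ^ ((n : ℝ) - γ) :=
      Real.rpow_le_rpow (norm_nonneg _) hw3.le (sub_nonneg.2 hγn)
    have hnn : 0 ≤ ‖w - c‖ ^ γ * ‖H w‖ := by positivity
    have key : ‖(w - c) ^ n * H w‖ ≤ (3 * s) ^ ((n : ℝ) - γ) * (‖w - c‖ ^ γ * ‖H w‖) := by
      rw [norm_mul, norm_pow, hsplit, mul_assoc]
      exact mul_le_mul_of_nonneg_right hle hnn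
    calc (‖(w - c) ^ n * H w‖ₑ : ℝ≥0∞) = ENNReal.ofReal ‖(w - c) ^ n * H w‖ := (ofReal_norm _).symm
      _ ≤ ENNReal.ofReal ((3 * s) ^ ((n : ℝ) - γ) * (‖w - c‖ ^ γ * ‖H w‖)) :=
          ENNReal.ofReal_le_ofReal key
      _ = ENNReal.ofReal ((3 * s) ^ ((n : ℝ) - γ)) * ‖(‖w - c‖ ^ γ * ‖H w‖)‖ₑ := by
          rw [ENNReal.ofReal_mul (by positivity), Real.enorm_eq_ofReal hnn]
  calc ENNReal.ofReal (π * s ^ 2) * ‖(z - c) ^ n * H z‖ₑ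
      ≤ ∫⁻ w in ball z s, ‖(w - c) ^ n * H w‖ₑ := h1
    _ ≤ ∫⁻ w in ball z s, ENNReal.ofReal ((3 * s) ^ ((n : ℝ) - γ)) * ‖(‖w - c‖ ^ γ * ‖H w‖)‖ₑ :=
        setLIntegral_mono' measurableSet_ball hpt
    _ = ENNReal.ofReal ((3 * s) ^ ((n : ℝ) - γ)) * ∫⁻ w in ball z s, ‖(‖w - c‖ ^ γ * ‖H w‖)‖ₑ :=
        lintegral_const_mul' _ _ ENNReal.ofReal_ne_top
    _ ≤ ENNReal.ofReal ((3 * s) ^ ((n : ℝ) - γ)) *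
          ∫⁻ w in ball c r \ {c}, ‖(‖w - c‖ ^ γ * ‖H w‖)‖ₑ :=
        mul_le_mul_right (lintegral_mono_set hsub) _

/-- **Removable singularity from a weighted area-`L¹` bound (measurable `H`).**  If `H` is
measurable, holomorphic on `B(c, r) ∖ {c}` (`r > 0`), `w ↦ ‖w - c‖ ^ γ ‖H w‖` is integrable
there, `0 ≤ γ` and `γ + 1 < n`, then `f(z) = (z - c) ^ n H(z)` satisfies
`‖z - c‖ ‖f z‖ ≤ C ‖z - c‖ ^ (n - γ - 1)` near `c` (key estimate), hence `f = o((z - c)⁻¹)` at `c`,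
and `f`, redefined at `c` as its punctured limit, is holomorphic on `B(c, r)` (Riemann).
[folklore] -/
theorem differentiableOn_update_pow_mul_of_weightedL1 {H : ℂ → ℂ} {c : ℂ} {r γ : ℝ} {n : ℕ}
    (hr : 0 < r) (hγ : 0 ≤ γ) (hn : γ + 1 < n) (hHm : Measurable H)
    (hH : DifferentiableOn ℂ H (ball c r \ {c}))
    (hint : IntegrableOn (fun z => (‖z - c‖ ^ γ : ℝ) * ‖H z‖) (ball c r \ {c})) :
    DifferentiableOn ℂ (Function.update (fun z => (z - c) ^ n * H z) c
      (limUnder (𝓝[≠] c) fun z => (z - c) ^ n * H z)) (ball c r) := by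
  have hd : DifferentiableOn ℂ (fun z => (z - c) ^ n * H z) (ball c r \ {c}) :=
    fun w hw => ((differentiableWithinAt_id.sub_const c).pow n).mul (hH w hw)
  refine Complex.differentiableOn_update_limUnder_of_isLittleO (ball_mem_nhds c hr) hd ?_
  -- constants
  set I : ℝ≥0∞ := ∫⁻ w in ball c r \ {c}, ‖(‖w - c‖ ^ γ * ‖H w‖)‖ₑ with hI
  have hIfin : I < ∞ := hint.hasFiniteIntegral
  set α : ℝ := (n : ℝ) - γ - 1 with hα
  have hα0 : 0 < α := by rw [hα]; linarith
  have hnα : (n : ℝ) - γ = α + 1 := by rw [hα]; ring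
  have hn0 : n ≠ 0 := by
    rintro rfl
    simp only [Nat.cast_zero] at hn
    linarith
  have hfc : (c - c) ^ n * H c = 0 := by simp [hn0]
  set K : ℝ := 2 / π * ((3 : ℝ) ^ (α + 1) * I.toReal) with hK
  -- the pointwise bound near `c`
  have hbound : ∀ z : ℂ, z ≠ c → ‖z - c‖ < 2 * r / 3 →
      ‖z - c‖ * ‖(z - c) ^ n * H z‖ ≤ K * (‖z - c‖ / 2) ^ α := by
    intro z hzc hz
    have hkey := pi_mul_sq_mul_enorm_pow_mul_le (le_of_lt (by linarith : γ < n)) hHm hH hzc hz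
    set s : ℝ := ‖z - c‖ / 2 with hs
    have hzc' : 0 < ‖z - c‖ := norm_pos_iff.2 (sub_ne_zero.2 hzc)
    have hs0 : 0 < s := by positivity
    have h2s : ‖z - c‖ = 2 * s := by rw [hs]; ring
    -- pass to real numbers
    have hne : ENNReal.ofReal ((3 * s) ^ ((n : ℝ) - γ)) * I ≠ ∞ :=
      ENNReal.mul_ne_top ENNReal.ofReal_ne_top hIfin.ne
    have h1 : π * s ^ 2 * ‖(z - c) ^ n * H z‖ ≤ (3 * s) ^ ((n : ℝ) - γ) * I.toReal := by
      have h := ENNReal.toReal_mono hne hkey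
      rwa [ENNReal.toReal_mul, ENNReal.toReal_mul, ENNReal.toReal_ofReal (by positivity),
        toReal_enorm, ENNReal.toReal_ofReal (by positivity)] at h
    have h3 : (3 * s) ^ ((n : ℝ) - γ) = 3 ^ (α + 1) * s ^ α * s := by
      rw [hnα, Real.mul_rpow (by norm_num) hs0.le, Real.rpow_add hs0, Real.rpow_one]
      ring
    rw [h3] at h1
    -- cancel one factor `s`
    have h4 : π * s * ‖(z - c) ^ n * H z‖ ≤ 3 ^ (α + 1) * I.toReal * s ^ α := by
      have h5 : (π * s * ‖(z - c) ^ n * H z‖) * s ≤ (3 ^ (α + 1) * I.toReal * s ^ α) * s := by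
        calc (π * s * ‖(z - c) ^ n * H z‖) * s = π * s ^ 2 * ‖(z - c) ^ n * H z‖ := by ring
          _ ≤ 3 ^ (α + 1) * s ^ α * s * I.toReal := h1
          _ = (3 ^ (α + 1) * I.toReal * s ^ α) * s := by ring
      exact le_of_mul_le_mul_right h5 hs0
    calc ‖z - c‖ * ‖(z - c) ^ n * H z‖ = 2 / π * (π * s * ‖(z - c) ^ n * H z‖) := by
          rw [h2s]; field_simp
      _ ≤ 2 / π * (3 ^ (α + 1) * I.toReal * s ^ α) :=
          mul_le_mul_of_nonneg_left h4 (by positivity)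
      _ = K * s ^ α := by rw [hK]; ring
  -- the majorant tends to `0`
  have ht : Tendsto (fun z : ℂ => K * (‖z - c‖ / 2) ^ α) (𝓝 c) (𝓝 0) := by
    have h1 : Tendsto (fun z : ℂ => ‖z - c‖ / 2) (𝓝 c) (𝓝 0) := by
      have hc' : Continuous fun z : ℂ => ‖z - c‖ / 2 := by fun_prop
      simpa using hc'.tendsto c
    have h2 : Tendsto (fun z : ℂ => K * (‖z - c‖ / 2) ^ α) (𝓝 c) (𝓝 (K * (0 : ℝ) ^ α)) :=
      (((Real.continuous_rpow_const hα0.le).tendsto 0).comp h1).const_mul K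
    rwa [Real.zero_rpow hα0.ne', mul_zero] at h2
  have hball : ∀ᶠ z in 𝓝 c, ‖z - c‖ < 2 * r / 3 :=
    Metric.eventually_nhds_iff.2 ⟨2 * r / 3, by positivity, fun z hz => by rwa [dist_eq_norm] at hz⟩
  refine Asymptotics.isLittleO_iff.2 fun ε hε => ?_
  filter_upwards [nhdsWithin_le_nhds ((ht.eventually_le_const hε).and hball),
    self_mem_nhdsWithin] with z hz hzc
  have hzc1 : z ≠ c := fun h => hzc h
  have hzc' : 0 < ‖z - c‖ := norm_pos_iff.2 (sub_ne_zero.2 hzc1)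
  rw [hfc, sub_zero, norm_inv, ← div_eq_mul_inv, le_div_iff₀ hzc', mul_comm]
  exact (hbound z hzc1 hz.2).trans hz.1

end Analysis

/-- **Registered sub-goal `pole_order_of_weightedL1` (corner singularities are poles of controlled
order).**  Let `H` be holomorphic on the punctured disc `B(c, r) ∖ {c}` (`r > 0`) with
`w ↦ ‖w - c‖ ^ γ ‖H w‖` area-integrable there, `0 ≤ γ`, and let `n` be a natural number with
`γ + 1 < n`.  Then `(z - c) ^ n H(z)` extends to a holomorphic function `G` on `B(c, r)`.
(Replace `H` by `0` off the punctured disc to make it measurable, then apply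
`Analysis.differentiableOn_update_pow_mul_of_weightedL1`; `G` is `(z - c) ^ n H(z)` updated at `c`
by its punctured limit.) [folklore] -/
theorem pole_order_of_weightedL1 : ∀ (H : ℂ → ℂ) (c : ℂ) (r γ : ℝ) (n : ℕ), 0 < r → 0 ≤ γ → γ + 1 < n → DifferentiableOn ℂ H (Metric.ball c r \ {c}) → MeasureTheory.IntegrableOn (fun z => (‖z - c‖ ^ γ : ℝ) * ‖H z‖) (Metric.ball c r \ {c}) → ∃ G : ℂ → ℂ, DifferentiableOn ℂ G (Metric.ball c r) ∧ Set.EqOn G (fun z => (z - c) ^ n * H z) (Metric.ball c r \ {c}) := by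
  intro H c r γ n hr hγ hn hH hint
  classical
  -- WLOG `H` is measurable: replace it by `0` off the (open) punctured disc
  have hPm : MeasurableSet (ball c r \ {c}) := measurableSet_ball.diff (measurableSet_singleton c)
  set H₁ : ℂ → ℂ := (ball c r \ {c}).piecewise H 0 with hH₁
  have hEq : EqOn H₁ H (ball c r \ {c}) := fun w hw => Set.piecewise_eq_of_mem _ _ _ hw
  have hH₁m : Measurable H₁ :=
    hH.continuousOn.measurable_piecewise continuous_zero.continuousOn hPm
  have hH₁d : DifferentiableOn ℂ H₁ (ball c r \ {c}) := hH.congr hEq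
  have hint₁ : IntegrableOn (fun z => (‖z - c‖ ^ γ : ℝ) * ‖H₁ z‖) (ball c r \ {c}) :=
    hint.congr_fun (fun w hw => by simp only [hEq hw]) hPm
  refine ⟨Function.update (fun z => (z - c) ^ n * H₁ z) c
      (limUnder (𝓝[≠] c) fun z => (z - c) ^ n * H₁ z),
    Analysis.differentiableOn_update_pow_mul_of_weightedL1 hr hγ hn hH₁m hH₁d hint₁,
    fun z hz => ?_⟩
  rw [Function.update_of_ne (fun h => hz.2 h)]
  simp only [hEq hz]

end Summit.CriticalPhenomena.SAWScalingLimit.Theorems.PolygonParitySqueeze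

end
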